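/-
Copyright: the b2b-balaban cell (near-miss cell 7), T⁴-continuum fan-out; row NE7b ROUND-2 swarm, seat
t4-ne7b-formalise-leaf-02 (gen 3) — sub-row S6g′(a)-TOTAL, file 6 (the TOTAL on the FLAT genealogy `P.gen c`, the
shape-keyed tree the binding counts on).  Released under the licence of the surrounding project.
-/
import Summits.QuantumFields.BalabanUV.T4Continuum.Support.HistoryZoneMassTotalGen
import Summits.QuantumFields.BalabanUV.T4Continuum.Support.HistoryConsistent

/-!
# The class-linear TOTAL on the flat genealogy `P.gen c = gmap Prod.fst (P.genT c)` (row S6g′(a)-TOTAL, file 6)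

Summits-side support leaf of the T⁴-continuum cell (rung (B)+1 on a FINITE torus only; NOT infinite volume, NOT the
mass gap, NOT the Clay statement; NOT a proof of the spine estimate NE7b).  Row NE7b, route «COUNT», row S6g′
«MASS-BASED SIBLING COUNT».  The binding's symmetry credit (`HistoryJoinsAdm.key`: classes = EQUAL sub-structures)
is read on a tree whose labels are SHAPES, not tags — for a realised member, leaf-09's flat genealogy `P.gen c`
(`HistoryGen.Pedigree.gen`, labels in `PEv`, read by `id`).  File 5 stated the TOTAL on the tagged `P.genT c`; this file
states it on `P.gen c`, again from «oldest line first» ONLY: the dating transports along the tag-forgetting map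
(`HistoryZoneMassDatingGen.dated_relabel`, `HistoryConsistent.relabel_eq_gmap`), the chronology by leaf-06's
`HistoryChronoCanon.chronoZ_shape_of_canon`.  [folklore] composition BY NAME; nothing is quoted from print, nothing
printed is asserted, no `[cite:]` tag, no `Prop`-valued fact minted, constants symbolic.

WHAT.  `gen_eq_relabel`, `dated_gen`, `chronoZ_gen`, and the ENDs **`sum_joins_zmass_le_gen`**,
**`sum_joins_tparts_zmass_add_le_gen`**, **`finset_sum_joins_le_gen`** — hypotheses `0 ≤ θ < 1`, `0 ≤ WB`, `0 ≤ WM`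
(`0 ≤ γ`), `∀ c, P.HeadOldest c`; right-hand side `umass id WB WM (P.gen c) ∕ (1 − θ) (+ 2γ·nmerges (P.gen c))`, the flat
tree's own undecayed mass (class-linear by `umass_eq_bsum` on the flat tree).

HONEST SCOPE.  Bookkeeping over OUR carriers; the masses' binding to Bałaban's regions is H3; `BirthShapeNodup` is NOT
retired by this file; NE7b NOT proved; spine 0∕9.  HONEST DEPENDENCY (cell): continuum YM on T⁴ ⇐ BetaPertH ∧ nine spine
estimates (0/9 proved); BetaPertH ⇐ (D1) ∧ (D4) ∧ CAP+tail; G-an2-4 gates asym, D1 and NE2/3/4.  This file changes none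
of it.
-/

open Finset
open Literature.MathematicalPhysics.QuantumFieldTheory.Balaban1983to89
open T4PersistenceDictionary T4BranchingRecordsGas
open Summit.QuantumFields.BalabanUV.T4Continuum.ZoneSkeleton
open Summit.QuantumFields.BalabanUV.T4Continuum.ZoneTorus
open Summit.QuantumFields.BalabanUV.T4Continuum.HistoryGen
open Summit.QuantumFields.BalabanUV.T4Continuum.HistoryChronoCanon
open Summit.QuantumFields.BalabanUV.T4Continuum.HistoryZoneMassLaw
open Summit.QuantumFields.BalabanUV.T4Continuum.HistoryZoneMassJoins
open Summit.QuantumFields.BalabanUV.T4Continuum.HistoryZoneMassTotal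
open Summit.QuantumFields.BalabanUV.T4Continuum.HistoryZoneMassDatingGen

namespace Summit.QuantumFields.BalabanUV.T4Continuum.HistoryZoneMassTotalFlat

noncomputable section

variable {α π : Type*} [DecidableEq α] [DecidableEq π] {P : Pedigree α π} {θ WB WM : ℝ}

omit [DecidableEq α] [DecidableEq π] in
/-- the flat genealogy is the tag-forgetting relabelling of the tagged one [folklore] -/
theorem gen_eq_relabel (P : Pedigree α π) (c : α) : P.gen c = relabel Prod.fst (P.genT c) :=
  (HistoryConsistent.relabel_eq_gmap Prod.fst (P.genT c)).symm

/-- **THE FLAT GENEALOGY IS DATED** (strictly, under any step beyond its component's step) from «oldest line first».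
[folklore] -/
theorem dated_gen (hH : ∀ c, P.HeadOldest c) (c : α) {t : ℕ} (ht : P.step c < t) :
    Dated (PEv.step ∘ (id : PEv → PEv)) true t (P.gen c) := by
  rw [gen_eq_relabel]
  exact dated_relabel Prod.fst (st := PEv.step ∘ Prod.fst) (st' := PEv.step ∘ (id : PEv → PEv)) (fun _ => rfl)
    (dated_strict_genT hH c ht)

/-- **THE FLAT GENEALOGY IS CHRONOLOGICAL** (zone side) from «oldest line first». [folklore] -/
theorem chronoZ_gen (hH : ∀ c, P.HeadOldest c) (c : α) : ZoneSkeleton.Chrono (PEv.step ∘ (id : PEv → PEv)) (P.gen c) := by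
  rw [gen_eq_relabel]
  exact chronoZ_shape_of_canon Prod.fst (PEv.step ∘ (id : PEv → PEv)) (Pedigree.chronoC_genT hH c)

/-- **THE TOTAL ON THE FLAT GENEALOGY, LIST FORM.** [folklore] -/
theorem sum_joins_zmass_le_gen (hθ0 : 0 ≤ θ) (hθ1 : θ < 1) (hB : 0 ≤ WB) (hM : 0 ≤ WM) (hH : ∀ c, P.HeadOldest c)
    (c : α) :
    ((joins (PEv.step ∘ (id : PEv → PEv)) (P.gen c)).map fun X =>
        zmass (id : PEv → PEv) θ WB WM (ftime (PEv.step ∘ (id : PEv → PEv)) X) X).sum ≤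
      umass (id : PEv → PEv) WB WM (P.gen c) / (1 - θ) :=
  sum_joins_zmass_le hθ0 hθ1 hB hM (dated_gen hH c (Nat.lt_succ_self (P.step c))) (chronoZ_gen hH c)

/-- **THE TOTAL ON THE FLAT GENEALOGY WITH THE LAW'S ADDITIVE CONSTANT.** [folklore] -/
theorem sum_joins_tparts_zmass_add_le_gen (hθ0 : 0 ≤ θ) (hθ1 : θ < 1) (hB : 0 ≤ WB) (hM : 0 ≤ WM) {γ : ℝ}
    (hγ : 0 ≤ γ) (hH : ∀ c, P.HeadOldest c) (c : α) :
    ((joins (PEv.step ∘ (id : PEv → PEv)) (P.gen c)).map fun X =>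
        ((tparts (PEv.step ∘ (id : PEv → PEv)) X).map fun Q =>
          zmass (id : PEv → PEv) θ WB WM (ftime (PEv.step ∘ (id : PEv → PEv)) X) Q + γ).sum).sum ≤
      umass (id : PEv → PEv) WB WM (P.gen c) / (1 - θ) + 2 * γ * (nmerges (P.gen c) : ℝ) :=
  sum_joins_tparts_zmass_add_le hθ0 hθ1 hB hM hγ (dated_gen hH c (Nat.lt_succ_self (P.step c))) (chronoZ_gen hH c)

/-- **THE TOTAL ON THE FLAT GENEALOGY, FINSET FORM** (the binder's `MS`∕`hZtot` budget on the tree it counts on).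
[folklore] -/
theorem finset_sum_joins_le_gen (hθ0 : 0 ≤ θ) (hθ1 : θ < 1) (hB : 0 ≤ WB) (hM : 0 ≤ WM) {γ : ℝ} (hγ : 0 ≤ γ)
    (hH : ∀ c, P.HeadOldest c) (c : α) :
    ∑ X ∈ (joins (PEv.step ∘ (id : PEv → PEv)) (P.gen c)).toFinset,
        ((tparts (PEv.step ∘ (id : PEv → PEv)) X).map fun Q =>
          zmass (id : PEv → PEv) θ WB WM (ftime (PEv.step ∘ (id : PEv → PEv)) X) Q + γ).sum ≤
      umass (id : PEv → PEv) WB WM (P.gen c) / (1 - θ) + 2 * γ * (nmerges (P.gen c) : ℝ) :=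
  finset_sum_joins_le hθ0 hθ1 hB hM hγ (dated_gen hH c (Nat.lt_succ_self (P.step c))) (chronoZ_gen hH c)

end

end Summit.QuantumFields.BalabanUV.T4Continuum.HistoryZoneMassTotalFlat
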